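import Mathlib
import Summits.MatrixMultiplication.MatrixMultiplication.Theses.MatrixPointInterpolation

/-!
# Crux `FewPointMasquerades` — NEGATION lens: the SLOT-RANK lemma (strategist sketch, typed, sorried)

Strategist `planner-cstrat-stmt-MatrixMultiplication-18199-s1-0`, 2026-08-17.  Statements only
(proof in `Ideas/slot-rank.md`; exact rational toy certificate attached as item evidence `slot_rank_toy.py`, n = 5, k = 2,
N = 15).  Headline: an `N`-point shadow of `k × k` points of the corner pair `(N, E_{1n}) ∈ M_n(ℂ)²`
on any window `D ≥ 3n + 1` (its minimal generation degree is `2n - 2`, window `4n - 4 ≥ 3n + 1` for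
`n ≥ 5`) has `N · k³ ≥ n³`.  So the only masquerade family known (the one proving `LongMasquerade`
and refuting `TightWindows`) certifies `ω ≤ 3` and nothing more through `closes`; a
`FewPointMasquerades` witness (`N ≤ n^(2+ε)`, `k` fixed) must look completely different — by the
general slot principle below it must generate in degree `d < (3/2)·n + o(n)` as soon as one letter
(or one short word) is non-derogatory.

MECHANISM (three slots).  For slot words `w_{abc} = y xᵃ y xᵇ y xᶜ y` the point functionals
`(a,b,c) ↦ w_{abc}(X,Y)` factor through the commutative algebra map
`Θ_X : ℂ[z₁,z₂,z₃] → M_k ⊗ M_k ⊗ M_k`, `z₁ᵃz₂ᵇz₃ᶜ ↦ Xᵃ ⊗ Xᵇ ⊗ Xᶜ` (then `P⊗Q⊗R ↦ Y P Y Q Y R Y` is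
linear), whose image has dimension `≤ k³` (Cayley–Hamilton).  If `N k³ < n³` some non-zero `g`
supported in the box `[0,n-1]³` lies in `⋂_t ker Θ_{X_t}`; with `α` a top-degree monomial of `g`
and `q := g · z^((n-1,n-1,n-1) - α)` (total degree `≤ 3(n-1)`), `Θ_{X_t}(q) = Θ(g)Θ(·) = 0` at every
point, while at the corner pair `E Nᵃ E = [a = n-1] E` gives `∑ q_{abc} w_{abc}(A) = q_{top} E = g_α E ≠ 0`.
-/

set_option linter.dupNamespace false

namespace Summit.MatrixMultiplication.MatrixMultiplication.Cruxes.FewPointMasquerades.SlotRank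

open scoped BigOperators

/-- The corner pair of size `m + 1`: letter `0` = the subdiagonal shift `N` (`N e_j = e_{j+1}`),
letter `1` = the corner unit `E_{1n}` (same formulas as `TightWindowsNeg.corner_pair_exists`). -/
def cornerPair (m : ℕ) : Fin 2 → Matrix (Fin (m + 1)) (Fin (m + 1)) ℂ :=
  ![Matrix.of fun i j => if (i : ℕ) = (j : ℕ) + 1 then 1 else 0,
    Matrix.of fun i j => if (i : ℕ) = 0 ∧ (j : ℕ) = m then 1 else 0]

/-- `IsShadow n k N D A B`: every combination of words of length `≤ D` vanishing at the `N` points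
`B t ∈ M_k(ℂ)²` vanishes at `A ∈ M_n(ℂ)²` (the last conjunct of `FewPointMasquerades` with `D = 2d`). -/
def IsShadow (n k N D : ℕ) (A : Fin 2 → Matrix (Fin n) (Fin n) ℂ)
    (B : Fin N → Fin 2 → Matrix (Fin k) (Fin k) ℂ) : Prop :=
  ∀ (T : Finset (List (Fin 2))) (c : List (Fin 2) → ℂ), (∀ w ∈ T, w.length ≤ D) →
    (∀ t : Fin N, (∑ w ∈ T, c w • (w.map (B t)).prod) = 0) → (∑ w ∈ T, c w • (w.map A).prod) = 0

/-- The three-slot word `y xᵃ y xᵇ y xᶜ y` (letters: `x = 0`, `y = 1`), of length `a + b + c + 4`. -/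
def slotWord (e : ℕ × ℕ × ℕ) : List (Fin 2) :=
  [1] ++ List.replicate e.1 0 ++ [1] ++ List.replicate e.2.1 0 ++ [1] ++ List.replicate e.2.2 0 ++ [1]

theorem slotWord_length (e : ℕ × ℕ × ℕ) : (slotWord e).length = e.1 + e.2.1 + e.2.2 + 4 := by
  simp [slotWord]; omega

/-- GAP LAW at the corner pair, three slots: `E Nᵃ E Nᵇ E Nᶜ E = [a = b = c = m] · E`.
(M-sized; the one-slot law `E Nᵃ E = [a = m] E` is inside `TightWindowsNeg.corner_pair_exists`.) -/
theorem stub_corner_slot_eval (m : ℕ) (e : ℕ × ℕ × ℕ) :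
    ((slotWord e).map (cornerPair m)).prod =
      if e = (m, m, m) then cornerPair m 1 else 0 := by
  sorry

/-- POINT SIDE (the slot-rank count; M/L-sized: Kronecker factorisation through `ℂ[z₁,z₂,z₃]`,
Cayley–Hamilton dimension bound `k³` per point, rank–nullity on the `(m+1)³` box monomials, top-degree
multiplier).  If `N k³ < (m+1)³` there is a finitely supported coefficient vector `q` on exponent
triples of total degree `≤ 3m`, with `q (m,m,m) ≠ 0`, whose slot-word combination vanishes at every
one of the `N` points. -/
theorem stub_exists_separating_combination (m k N : ℕ)
    (B : Fin N → Fin 2 → Matrix (Fin k) (Fin k) ℂ) (hN : N * k ^ 3 < (m + 1) ^ 3) :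
    ∃ q : (ℕ × ℕ × ℕ) →₀ ℂ, (∀ e ∈ q.support, e.1 + e.2.1 + e.2.2 ≤ 3 * m) ∧ q (m, m, m) ≠ 0 ∧
      ∀ t : Fin N, (∑ e ∈ q.support, q e • ((slotWord e).map (B t)).prod) = 0 := by
  sorry

/-- **SLOT-RANK LEMMA (corner pair).**  A window-`D` shadow of the corner pair of size `n = m + 1`
by `N` points of `M_k(ℂ)²` with `D ≥ 3m + 4 = 3n + 1` has `n³ ≤ N k³`.  In particular, at its minimal
generation degree `d = 2n - 2` (window `4n - 4 ≥ 3n + 1` iff `n ≥ 5`) — and a fortiori at any larger `d` —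
the corner pair is at best an `(n/k)³`-point masquerade: fed to `closes` it yields `ω ≤ 3`. -/
theorem corner_pointCount (m k N D : ℕ) (B : Fin N → Fin 2 → Matrix (Fin k) (Fin k) ℂ)
    (hD : 3 * m + 4 ≤ D) (hS : IsShadow (m + 1) k N D (cornerPair m) B) :
    (m + 1) ^ 3 ≤ N * k ^ 3 := by
  -- from the two stubs: take `T = slotWord '' q.support`, `c (slotWord e) = q e` (slotWord injective),
  -- lengths ≤ 3m + 4 ≤ D; the point sums vanish, so the `A`-sum `= q(m,m,m) • E_{1n}` vanishes: absurd.
  sorry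

/-! ## General slot principle (informal; the statement that shapes any witness)

Let `A ∈ M_n(ℂ)²` admit an `N`-point shadow of `k × k` points on the window `2d`, and suppose some
non-commutative polynomial `u` of degree `r` has `u(A)` NON-DEROGATORY.  For `s` slots the point
functionals on `p₀ u^{a₁} p₁ ⋯ u^{a_s} p_s` factor through schemes of length `≤ k^s`, the `A`-side
through `ℂ[z]/(μ_{u(A)})^{⊗ s}` (length `n^s`); whenever short outer words `pᵢ` make the slice
functional have support `> N k^s` (always possible with `|pᵢ| = o(n)` once `A` generates), the same
kernel/multiplier argument needs only the budget `s (n-1) r + ∑|pᵢ| ≤ 2d`.  Consequences: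
* `s = 3`: `N k³ ≥ c·n³` for every shadow of a pair with a non-derogatory letter and `d ≥ (3/2 + δ) n`;
* hence a `FewPointMasquerades` witness (`N ≤ n^(2+ε)`, `k` fixed, `n → ∞`) with a non-derogatory
  letter or short word generates in degree `d < (3/2) n + o(n)`, while (LooseMasquerades, anti-RR)
  `d ≥ c_k n^(2/k²)` and (letter counting, `FivePointCorner` HONEST LIMIT) every count-based masquerade
  has `d ≥ n - 1`: the live window for witnesses is `n^(2/k²) ≲ d < 1.5 n`, where NO masquerade of any
  `M_k` is currently known.
-/

end Summit.MatrixMultiplication.MatrixMultiplication.Cruxes.FewPointMasquerades.SlotRank
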